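import Summits.BirchSwinnertonDyer.BirchSwinnertonDyer.Theorems.PrintCf2RamifiedOffTYZLowerHalfTwoPrimesEven
import Literature.NumberTheory.EllipticCurves.CongruentNumberMonskySelmerParityBound
import Literature.NumberTheory.EllipticCurves.Smith2016.CongruentNumberGenusDeterminantUnconditional
import Literature.NumberTheory.EllipticCurves.TianYuanZhang2017.CMPointFrobeniusFourDisplays
import HarnessLib

/-!
# Crux `PrintCf2.RamifiedOffTYZOfFacts` (stmt-BirchSwinnertonDyer-20509), line `offtyz-v7`, LEAD cycle 13 (cruxlead-20509 g12):
# THE EVEN TWO-PRIME LOWER HALF IN DISPLAY SHAPE — `𝓛(l)` even from Thm 1.1 + Heath-Brown's one-prime table, and the packaging over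
# `D.Printed` (sequel of `…SquareSilenceTwoPrimesEven` p732749 and `…LowerHalfTwoPrimesEven` p733231)

THEOREMS ONLY (no `def`, no named fact, no `sorry`), `--supports stmt-BirchSwinnertonDyer-20509` (item 23431 = C⁺, even sectors E1/E2).
* §1 `even_scriptL_of_prime_one_mod_eight`: for a prime `l ≡ 1 (mod 8)` dividing `n`, the data's sign choice `D.scriptL l` is EVEN — Thm 1.1
  (`thm11_parity_of_scriptL`: `𝓛(l) ≡ Σ_genus g`), Smith 2016 Thm 1.2 (that sum is odd iff `#Sel₂(E_l) = 4`, tree theorem) and Heath-Brown's table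
  (`#Sel₂(E_l) = 16`, tree theorem).  This removes the hypothesis `Even (D.scriptL l)` of the two previous files.
* §2 `two_dvd_scriptL_two_primes_even_of_displays`, `levelTwo_iff_galPt_genusPoint_ne_two_primes_even_of_displays`: the lower half of C⁺ and its
  one-bit form on `n = 2lq` (`l ≡ 1 (8)`, `q ≡ 3 (4)`, `(l/q) = 1`), hypotheses = GZK, analytic rank one, `D.Printed`, Thm 1.1 by name, the CM-point
  layer objects with `CMBlockSpec`/`SevenBlockSpec` on every block, and the Frobenius clause of `𝔭_l` WITH (F5) «`φ_l ∉ Gal(ℍ′_n/H_n)`» (the one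
  printed sentence not yet displayed — the subgroups must stay unpacked to state it; when `FrobeniusFourBlockSpec` carries (F5) this becomes an
  `OfFacts` closer by name), and a generator with `x(R) ∉ {±1, ±2, ±n, ±2n}·ℚ^{×2}` (resp. an explicit half-mover).
Beyond-print theorem: YES (conditional on the displays and (F5)).  BSD is not proved by any of this; no class is closed by this file.

References: [cite: TianYuanZhang2017, Thm. 1.1 (p0002 L90–L99), §1 (p0002 L101–L110), §3 (Prop. 3.2 (2), Thm. 3.5, Thm. 3.6 (2), Lemma 3.18, proof of
Lemma 3.21)]; [cite: Smith2016CongruentDensity, Thm. 1.2]; [cite: HeathBrown1994SelmerCongruentII, §1 typescript p. 6 L26–L28, Appendix (Monsky)];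
[cite: Cox2013, §5.C (5.22), Cor. 5.21, §9.A]; [cite: Darmon2004, Thm. 3.22].
-/

noncomputable section

open scoped Classical

open WeierstrassCurve WeierstrassCurve.Affine Finset Literature.NumberTheory.EllipticCurves
  Literature.NumberTheory.EllipticCurves.TianYuanZhang2017
  Literature.NumberTheory.EllipticCurves.TianYuanZhang2017.W2
  Literature.NumberTheory.EllipticCurves.MonskySelmerParity
  Literature.NumberTheory.EllipticCurves.Smith2016
  Summit.BirchSwinnertonDyer.PrintCf2.LowerHalfTwoPrimesEven
  Summit.BirchSwinnertonDyer.PrintCf2.SquareSilenceEven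

set_option autoImplicit false

namespace Summit.BirchSwinnertonDyer.PrintCf2.LowerHalfTwoPrimesEvenDisplays

variable {n : ℕ}

/-! ## §1 `𝓛(l)` is even for a prime `l ≡ 1 (mod 8)` dividing `n` (Thm 1.1 + Heath-Brown's one-prime table `s(l) = 2`) -/

/-- **`𝓛(l)` is EVEN for a prime `l ≡ 1 (mod 8)`** (any sign choice recorded in the data, `l ∣ n`): by Thm 1.1 (`thm11_parity_of_scriptL`)
`𝓛(l) ≡ Σ_{genus} g` (mod 2), and that genus sum is odd iff `#Sel₂(E_l/ℚ) = 4` (Smith 2016 Thm 1.2, tree theorem), whereas `#Sel₂(E_l) = 16` for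
`l ≡ 1 (mod 8)` (Heath-Brown's table, tree theorem).
[cite: TianYuanZhang2017, Thm. 1.1 (p0002 L90–L99)] [cite: Smith2016CongruentDensity, Thm. 1.2] [cite: HeathBrown1994SelmerCongruentII, §1 typescript p. 6 L26–L28] -/
theorem even_scriptL_of_prime_one_mod_eight (h11 : thm11_parity_of_scriptL) (D : GenusPointData n) (hLs : D.scriptLSpec)
    {l : ℕ} (hl : l.Prime) (hl8 : l % 8 = 1) (hln : l ∈ n.divisors) : Even (D.scriptL l) := by
  have hlsq : Squarefree l := hl.squarefree
  obtain ⟨L, hL, hLpar⟩ := h11 l hlsq (Or.inl hl8) GenusField (isGenusFieldFamily_genusField l)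
  have hsel : Nat.card ((congruentNumberCurve l).selmerGroup 2) = 16 := by
    rw [card_selmerGroup_two_congruentNumberCurve_prime hl (by omega), if_pos hl8]
  have hno : ¬ Odd (genusSum₁ l fun d => genusClassNumber (GenusField d)) := fun ho => by
    have h4 := (card_selmerGroup_two_eq_four_iff_odd_genusSum₁' hlsq hl8).mpr ho
    rw [hsel] at h4
    exact absurd h4 (by norm_num)
  have hL2 : Even L := by
    have hz : (L : ZMod 2) = 0 := by
      rw [hLpar, (ZMod.natCast_eq_zero_iff_even).mpr (Nat.not_odd_iff_even.mp hno)]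
    exact (ZMod.intCast_eq_zero_iff_even).mp hz
  have hLD : IsScriptL l (D.scriptL l) := hLs l hln hl.one_lt
  rcases LevelTwo.eq_or_eq_neg_of_isScriptL hLD hL with h | h
  · rw [h]; exact hL2
  · rw [h]; exact hL2.neg

/-! ## §2 The lower half in display shape -/

/-- **THE LOWER HALF ON THE EVEN TWO-PRIME JUMP-ONE CLASS, display shape.**  `n = 2lq` square-free, `l ≡ 1 (mod 8)`, `q ≡ 3 (mod 4)`, `(l/q) = 1`,
analytic rank one, GZK; data `D : GenusPointData n` with `D.Printed` and the CM-point layer OBJECTS of `CMPointRingClassFrobeniusFourPrinted` (unpacked: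
the subgroups are needed to STATE the Frobenius clause of `𝔭_l` WITH (F5) «`φ_l ∉ Gal(ℍ′_n/H_n)`», which the display does not yet carry); TYZ Thm 1.1 by
name; a generator `R = (x, y)` of `E_n(ℚ)` modulo torsion with `x ∉ {±1, ±2, ±n, ±2n}·ℚ^{×2}`.  Then `2 ∣ L` whenever `𝓛(n)² = L²`.
[cite: TianYuanZhang2017, Thm. 1.1, §1 (p0002 L101–L110), §3 (Prop. 3.2 (2), Thm. 3.5, Thm. 3.6 (2), Lemma 3.18, proof of Lemma 3.21)]
[cite: HeathBrown1994SelmerCongruentII, §1 and Appendix (Monsky)] [cite: Cox2013, §5.C (5.22), Cor. 5.21, §9.A] [cite: Darmon2004, Thm. 3.22] -/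
theorem two_dvd_scriptL_two_primes_even_of_displays (hGZK : rank_eq_analyticRank_of_analyticRank_le_one)
    (hsq : Squarefree n) {l q : ℕ} (hl : l.Prime) (hq : q.Prime) (hlq : l ≠ q) (hn : n = 2 * l * q) (hl8 : l % 8 = 1)
    (hq4 : q % 4 = 3) (hleg : jacobiSym l q = 1)
    (hr : haveI := isElliptic_congruentNumberCurve hsq.ne_zero; (congruentNumberCurve n).analyticRank = 1)
    (D : GenusPointData n) (hPr : D.Printed) (h11 : thm11_parity_of_scriptL)
    (z : ℕ → APoint D.H) (Φ : ℕ → Finset (D.H ≃ₐ[ℚ] D.H)) (ΓH ΓH' : ℕ → Subgroup (D.H ≃ₐ[ℚ] D.H))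
    (σ : ℕ → (D.H ≃ₐ[ℚ] D.H)) (c : D.H ≃ₐ[ℚ] D.H) (hc : D.ConjSpec c)
    (hblock : ∀ d ∈ n.divisors, ((d % 8 = 5 ∨ d % 8 = 6) → D.CMBlockSpec d (z d) (Φ d) (ΓH d) (ΓH' d) (σ d) c) ∧
      (d % 8 = 7 → D.SevenBlockSpec d))
    (hFrobl : ∃ φ : D.H ≃ₐ[ℚ] D.H, φ (D.sqrtNeg n) = D.sqrtNeg n ∧ φ * φ ∈ ΓH' n ∧ φ D.im = (jacobiSym (-1) l) • D.im ∧
      (∀ r : ℕ, r.Prime → r ∣ n → r ≠ l → φ (D.sqrtNeg r) = (jacobiSym (-(r : ℤ)) l) • D.sqrtNeg r) ∧ φ ∉ ΓH n)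
    {x y : ℚ} (hxy : (congruentNumberCurve n).toAffine.Nonsingular x y)
    (hgen : haveI := isElliptic_congruentNumberCurve hsq.ne_zero;
      ∀ P, ∃ k : ℤ, IsOfFinAddOrder (P - k • (Point.some x y hxy : (congruentNumberCurve n).toAffine.Point)))
    (hx : ¬ ∃ r : ℚ, x = r ^ 2 ∨ x = -r ^ 2 ∨ x = n * r ^ 2 ∨ x = -(n * r ^ 2))
    (hx2 : ¬ ∃ r : ℚ, x = 2 * r ^ 2 ∨ x = -(2 * r ^ 2) ∨ x = 2 * n * r ^ 2 ∨ x = -(2 * n * r ^ 2)) :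
    ∀ L : ℤ, IsScriptL n L → (2 : ℤ) ∣ L := by
  obtain ⟨hLs, -, hrec, -, h35, -, -, -, h318, -, -⟩ := hPr
  have hln : l ∈ n.divisors := Nat.mem_divisors.mpr ⟨⟨2 * q, by rw [hn]; ring⟩, hsq.ne_zero⟩
  have hLl : Even (D.scriptL l) := even_scriptL_of_prime_one_mod_eight h11 D hLs hl hl8 hln
  exact two_dvd_scriptL_two_primes_even_of_x_not_mem hGZK hsq hl hq hlq hn hl8 hq4 hleg hr D hrec h35 hLs h318 z Φ ΓH ΓH' σ c hc hblock hLl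
    hFrobl hxy hgen hx hx2

/-- **C⁺ AS ONE GALOIS BIT, display shape** (same data with the half-mover made explicit): for any half `Q₁` of the twisted generator and any `g₀`
fixing `i`, `√−2`, `√−n` with `g₀·Q₁ ≠ Q₁`, the conclusion of C⁺ at `n` holds iff `g₀·P(n) ≠ P(n)`.
[cite: TianYuanZhang2017, Thm. 1.1, §3 (Prop. 3.2 (2), Thm. 3.5, Thm. 3.6 (2), Lemma 3.18, proof of Lemma 3.21)] [cite: Darmon2004, Thm. 3.22] -/
theorem levelTwo_iff_galPt_genusPoint_ne_two_primes_even_of_displays (hGZK : rank_eq_analyticRank_of_analyticRank_le_one)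
    (hsq : Squarefree n) {l q : ℕ} (hl : l.Prime) (hq : q.Prime) (hlq : l ≠ q) (hn : n = 2 * l * q) (hl8 : l % 8 = 1)
    (hq4 : q % 4 = 3) (hleg : jacobiSym l q = 1)
    (hr : haveI := isElliptic_congruentNumberCurve hsq.ne_zero; (congruentNumberCurve n).analyticRank = 1)
    (D : GenusPointData n) (hPr : D.Printed) (h11 : thm11_parity_of_scriptL)
    (z : ℕ → APoint D.H) (Φ : ℕ → Finset (D.H ≃ₐ[ℚ] D.H)) (ΓH ΓH' : ℕ → Subgroup (D.H ≃ₐ[ℚ] D.H))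
    (σ : ℕ → (D.H ≃ₐ[ℚ] D.H)) (c : D.H ≃ₐ[ℚ] D.H) (hc : D.ConjSpec c)
    (hblock : ∀ d ∈ n.divisors, ((d % 8 = 5 ∨ d % 8 = 6) → D.CMBlockSpec d (z d) (Φ d) (ΓH d) (ΓH' d) (σ d) c) ∧
      (d % 8 = 7 → D.SevenBlockSpec d))
    (hFrobl : ∃ φ : D.H ≃ₐ[ℚ] D.H, φ (D.sqrtNeg n) = D.sqrtNeg n ∧ φ * φ ∈ ΓH' n ∧ φ D.im = (jacobiSym (-1) l) • D.im ∧
      (∀ r : ℕ, r.Prime → r ∣ n → r ≠ l → φ (D.sqrtNeg r) = (jacobiSym (-(r : ℤ)) l) • D.sqrtNeg r) ∧ φ ∉ ΓH n)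
    {R : (congruentNumberCurve n).toAffine.Point}
    (hR : haveI := isElliptic_congruentNumberCurve hsq.ne_zero; ∀ P, ∃ k : ℤ, IsOfFinAddOrder (P - k • R))
    {Q₁ : APoint D.H} (hQ₁ : φH D Q₁ = Point.map (W' := curveA.twoIsogenyCodomain)
      (D.embK n (Nat.mem_divisors_self n hsq.ne_zero)) (ΘE hsq.ne_zero R))
    (g₀ : D.H ≃ₐ[ℚ] D.H) (hgi : g₀ D.im = D.im) (hg2 : g₀ (D.sqrtNeg 2) = D.sqrtNeg 2) (hgK : g₀ (D.sqrtNeg n) = D.sqrtNeg n)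
    (hmoveQ : D.galPt g₀ Q₁ ≠ Q₁) :
    (∀ L : ℤ, IsScriptL n L → (2 : ℤ) ∣ L ∧ ¬ (4 : ℤ) ∣ L) ↔ D.galPt g₀ (D.P n) ≠ D.P n := by
  obtain ⟨hLs, -, hrec, -, h35, -, -, -, h318, -, -⟩ := hPr
  have hln : l ∈ n.divisors := Nat.mem_divisors.mpr ⟨⟨2 * q, by rw [hn]; ring⟩, hsq.ne_zero⟩
  have hLl : Even (D.scriptL l) := even_scriptL_of_prime_one_mod_eight h11 D hLs hl hl8 hln
  exact levelTwo_iff_galPt_genusPoint_ne_two_primes_even_of_halfMover hGZK hsq hl hq hlq hn hl8 hq4 hleg hr D hrec h35 hLs h318 z Φ ΓH ΓH' σ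
    c hc hblock hLl hFrobl hR hQ₁ g₀ hgi hg2 hgK hmoveQ

end Summit.BirchSwinnertonDyer.PrintCf2.LowerHalfTwoPrimesEvenDisplays

end
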